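import Literature.MathematicalPhysics.QuantumFieldTheory.Balaban1983to89.B4PartitionUnity22
import Literature.MathematicalPhysics.QuantumFieldTheory.Balaban1983to89.B4SubBoxCarrier

/-!
# `Balaban1983to89.B6Partition236TwoLevelBox` — [B6] (2.36) at mesh `L^{−j}` WITH THE PRINTED (1.118) PROFILE on a box,
the cut cubes `□ = Ω ∩ (2M-cube)` as sub-boxes, and the unit-scale sizes `∂h_□ = O(M^{−1})`, `Δh_□ = O(M^{−2})` on every
cut cube (file 1/3 of the genuine two-level parametrix (2.36)–(2.38), (2.49)–(2.50); no existing module is touched; no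
fact is minted)

FRAMING (verbatim cell line):
statement-level skeleton of published theorems with citation tags; proofs where landed; nothing here is a claim about the Yang–Mills mass gap

Source under audit (cell pub-balaban): T. Bałaban, *Propagators and renormalization transformations for lattice gauge
theories. II*, Commun. Math. Phys. **96** (1984) 223–250 [`Balaban1984PropagatorsII`, "B6"], p. 229 [PDF 7] (2.36)–(2.39)
(render `b2b-balaban-ref1/pages/1984-cmp96-propagators-rt-II/…-p007-x2.png`, read as an image this generation);
T. Bałaban, *… I*, Commun. Math. Phys. **95** (1984) 17–40 [`Balaban1984PropagatorsI`, "B5"], p. 36 [PDF 20] (1.118);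
T. Bałaban, *Regularity and decay of lattice Green's functions*, Commun. Math. Phys. **89** (1983) 571–597
[`Balaban1983RegularityDecay`, "[3]" of B6], §2 p. 575 (the cubes `□_j = Ω ∩ {…}`), p. 577 («|∂^ηh_j| ≤ O(M⁻¹),
|Δ^ηh_j| ≤ O(M⁻²)»).

## WHAT IS PRINTED (verbatim up to notation)

[B6] p. 229: «Each set Λ_j is a sum of big blocks of the size ML^jη (Λ_j ⊂ T^{(j)}_{L^jη}), or of the size M if Λ_j is
scaled to unit lattice. We cover B^j(Λ_j) by a sum of cubes □ of the size 2ML^jη, each cube being a sum of 2^d big blocks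
with a center y ∈ Λ_j (more exactly it belongs to the boundary of this set also). … We construct also the corresponding
family of functions h described in (1.118), and rescale them to proper scales. They satisfy Σ_{□∈𝒟} h_□² = 1. (2.36)».
[B5] p. 36: «h_z(x) = Π_{μ=1}^d h((x_μ − z_μ)/M₀), h ∈ C₀^∞(]−⅔, ⅔[), h(t) = 1 for t ∈ [−⅓, ⅓], h is chosen in such a way
that Σ_n h²(t − n) = 1, hence Σ_z h_z²(x) = 1. (1.118)».  [3] p. 575: «□_j = Ω ∩ {a sum of large blocks for which the
point Mj is one of the vertices}. … if the point Mj is not a boundary point of Ω, then □_j is a cube of the size 2M and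
with center in Mj. For Mj lying on the boundary the set □_j is a sum of several (≤ 2^d) large blocks.»

## WHAT THIS FILE CERTIFIES (kernel-checked; the setting of the two-level lane `B6Ineq243TwoLevelBox`)

Units of `B6Ineq243TwoLevelBox`: mesh `1/n`, `n = L^j` fine sites per unit (`j`-)block, cube HALF-WIDTH `M` unit blocks,
`N := n·M` fine sites per half-width; the big box `Ω = Π_μ[0, N·P_μ)` (fine sites; `P_μ` half-widths per direction);
centres `Nq`, `q ∈ Π_μ{0, …, P_μ}` (the printed «center y … it belongs to the boundary of this set also»); a fine site `x`
sits at the physical position `x + ½` (so that the Neumann faces of `Ω` are the centre hyperplanes `q_μ ∈ {0, P_μ}`).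
* `hq n M q x = Π_μ h((x_μ + ½)/(nM) − q_μ)` with `h = B4PartitionUnity22.hprof ∈ C₀^∞(]−⅔,⅔[)`, `h = 1` on `[−⅓,⅓]`,
  `Σ_n h(t − n)² = 1` — THE PRINTED PROFILE (consumed by name: `hCube`, `hasSum_hCube_sq`, `abs_hCube_second_diff_le`);
* **`sum_hq_sq`** — (2.36) `Σ_{q ∈ Π[0,P_μ]} h_q(x)² = 1` at EVERY fine site of `Ω`;
* **`abs_hq_sub_le`** — the unit-scale Lipschitz size `|h_q(z′) − h_q(z)| ≤ ((d+1)·sup|h′|/M)·|z′ − z|_∞/n` («∂h = O(M⁻¹)»);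
* the CUT CUBES `□_q = Ω ∩ Π_μ[N(q_μ − 1), N(q_μ + 1))` as sub-boxes: corner `cubeLo` and width `cubeW ∈ {1, 2}` (in
  half-widths), `cubeLo_add_cubeW_le` (inside `Ω`), the local label `locLabel q ∈ {0,1}^{d+1}` with
  **`hq_shift`**: `h_q(z + N·cubeLo q) = h_{locLabel q}(z)` (the cut-off seen from the sub-box);
* **`hloc_laplacian`** — the unit-scale Laplacian size ON EVERY CUT CUBE, faces included:
  `|Σ_{z′ ∼ z, z′ ∈ □_q}(h(z′) − h(z))| ≤ (d+1)·sup|h″|/N²` at every site of the sub-box (interior: second differences;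
  at a face of the sub-box the one-sided difference VANISHES — either the face is a face of `Ω` through the centre and
  `h = 1` there (plateau `[−⅓,⅓]`, needs `N ≥ 4`), or `h = 0` within one site of the face (support `]−⅝,⅝[`));
* **`hloc_eq_zero_left/right`** — `h` vanishes on the two site layers along every INTERNAL face of a cut cube.

## HONEST SCOPE

Box `Ω` (Neumann) in place of the torus `T_η`; ONE cube size `2M` (unit blocks) over the whole box (in print the cubes
of `𝒟_{j+1}` inside `B^{j+1}(Λ_{j+1})` have size `2ML`; for the two-level operator the `𝒟_j`-size cubes serve everywhere,
(2.43)–(2.44) holding for every `Λ ⊆ □`, `B6Ineq243TwoLevelBox`); the profile is the tree's `hprof` (support `]−⅝,⅝[ ⊂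
]−⅔,⅔[`, plateau `[−⅜,⅜] ⊃ [−⅓,⅓]`); constants `sup|h′| = D1 hprof`, `sup|h″| = D2 hprof` existential (no numerical value).
Nothing is inferred from the manuscript: every step is kernel-checked; the quoted sentences locate the statement.
-/

namespace Literature.MathematicalPhysics.QuantumFieldTheory.Balaban1983to89.B6Partition236TwoLevelBox

open Finset
open Literature.MathematicalPhysics.QuantumFieldTheory.Balaban1983to89.B4Reflection242 (boxDom mem_boxDom nbrs mem_nbrs blk)
open Literature.MathematicalPhysics.QuantumFieldTheory.Balaban1983to89.B4Green242Bridge (boxNbrs sum_nbrs)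
open Literature.MathematicalPhysics.QuantumFieldTheory.Balaban1983to89.B4ContourShift (supNorm abs_le_supNorm supNorm_nonneg)
open Literature.MathematicalPhysics.QuantumFieldTheory.Balaban1983to89.B4PartitionUnity22

noncomputable section

variable {d : ℕ}

/-! ## §1 The printed cut-offs at mesh `1/n` -/

/-- the physical position `x + ½` of a fine site (the Neumann faces of a box `Π[0, S)` are the hyperplanes through
`−½` and `S − ½`, i.e. through integer multiples of the cube half-width). [folklore] -/
def pos (x : Fin (d + 1) → ℤ) : Fin (d + 1) → ℝ := fun μ => ((x μ : ℤ) : ℝ) + 1 / 2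

/-- **THE PRINTED CUT-OFF `h_□` OF (2.36)/(1.118) AT MESH `1/n`**: `h_q(x) = Π_μ h((x_μ + ½)/(nM) − q_μ)`, the
(1.118)-product of scale `M` unit blocks (`N = nM` fine sites) centred at `Nq`, `h = B4PartitionUnity22.hprof`.
[cite: Balaban1984PropagatorsII, (2.36) p.229; Balaban1984PropagatorsI, (1.118) p.36] -/
def hq (n M : ℕ) (q x : Fin (d + 1) → ℤ) : ℝ := hCube (((n * M : ℕ) : ℝ)) q (pos x)

/-- `0 ≤ h_q`. [cite: Balaban1984PropagatorsI, (1.118) p.36] -/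
theorem hq_nonneg (n M : ℕ) (q x : Fin (d + 1) → ℤ) : 0 ≤ hq n M q x := hCube_nonneg _ _ _

/-- `h_q ≤ 1`. [cite: Balaban1984PropagatorsI, (1.118) p.36] -/
theorem hq_le_one (n M : ℕ) (q x : Fin (d + 1) → ℤ) : hq n M q x ≤ 1 := hCube_le_one _ _ _

/-- `|h_q| ≤ 1`. [cite: Balaban1984PropagatorsI, (1.118) p.36] -/
theorem abs_hq_le_one (n M : ℕ) (q x : Fin (d + 1) → ℤ) : |hq n M q x| ≤ 1 := by
  rw [abs_of_nonneg (hq_nonneg n M q x)]; exact hq_le_one n M q x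

/-- the product formula with the factor of direction `μ` split off. [cite: Balaban1984PropagatorsI, (1.118) p.36] -/
theorem hq_eq_mul_prod (n M : ℕ) (q x : Fin (d + 1) → ℤ) (μ : Fin (d + 1)) :
    hq n M q x = hprof (pos x μ / ((n * M : ℕ) : ℝ) - q μ)
      * ∏ ν ∈ Finset.univ.erase μ, hprof (pos x ν / ((n * M : ℕ) : ℝ) - q ν) := by
  unfold hq hCube
  exact (Finset.mul_prod_erase Finset.univ _ (Finset.mem_univ μ)).symm

/-- the complementary factor lies in `[0, 1]`. [cite: Balaban1984PropagatorsI, (1.118) p.36] -/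
theorem prod_erase_mem (n M : ℕ) (q x : Fin (d + 1) → ℤ) (μ : Fin (d + 1)) :
    0 ≤ ∏ ν ∈ Finset.univ.erase μ, hprof (pos x ν / ((n * M : ℕ) : ℝ) - q ν)
      ∧ ∏ ν ∈ Finset.univ.erase μ, hprof (pos x ν / ((n * M : ℕ) : ℝ) - q ν) ≤ 1 :=
  ⟨Finset.prod_nonneg fun _ _ => hprof_nonneg _, Finset.prod_le_one (fun _ _ => hprof_nonneg _) fun _ _ => hprof_le_one _⟩

/-- **SUPPORT**: `h_q(x) ≠ 0 ⇒ |x_μ + ½ − Nq_μ| < ⅝N` in every direction. [cite: Balaban1984PropagatorsI, (1.118) p.36 («h ∈ C₀^∞(]−⅔, ⅔[)»)] -/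
theorem abs_lt_of_hq_ne_zero {n M : ℕ} (hN : 1 ≤ n * M) {q x : Fin (d + 1) → ℤ} (h : hq n M q x ≠ 0) (μ : Fin (d + 1)) :
    |pos x μ - ((n * M : ℕ) : ℝ) * q μ| < 5 / 8 * ((n * M : ℕ) : ℝ) :=
  hCube_ne_zero_imp (by exact_mod_cast hN) h μ

/-- **SUPPORT, contrapositive**: one far coordinate kills `h_q`. [cite: Balaban1984PropagatorsI, (1.118) p.36] -/
theorem hq_eq_zero_of_le {n M : ℕ} (hN : 1 ≤ n * M) {q x : Fin (d + 1) → ℤ} {μ : Fin (d + 1)}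
    (h : 5 / 8 * ((n * M : ℕ) : ℝ) ≤ |pos x μ - ((n * M : ℕ) : ℝ) * q μ|) : hq n M q x = 0 :=
  hCube_eq_zero (by exact_mod_cast hN) h

/-! ## §2 (2.36) on the box `Ω = Π_μ[0, N·P_μ)` -/

/-- the centre labels `q ∈ Π_μ{0, …, P_μ}` (centres `Nq`; «center y … it belongs to the boundary of this set also»).
[cite: Balaban1984PropagatorsII, p.229 (the cover 𝒟)] -/
def ctrs (P : Fin (d + 1) → ℕ) : Finset (Fin (d + 1) → ℤ) := Fintype.piFinset fun i => Finset.Icc (0 : ℤ) (P i)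

/-- membership in the centre set, coordinatewise. [cite: Balaban1984PropagatorsII, p.229 (the cover 𝒟)] -/
theorem mem_ctrs {P : Fin (d + 1) → ℕ} {q : Fin (d + 1) → ℤ} : q ∈ ctrs P ↔ ∀ i, 0 ≤ q i ∧ q i ≤ P i := by
  simp [ctrs, Fintype.mem_piFinset]

/-- only the centres of `Π[0, P_μ]` can see a site of the box. [cite: Balaban1984PropagatorsII, (2.36) p.229] -/
theorem mem_ctrs_of_hq_ne_zero {n M : ℕ} (hN : 1 ≤ n * M) {P S : Fin (d + 1) → ℕ} (hS : ∀ i, S i = n * M * P i)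
    {q x : Fin (d + 1) → ℤ} (hx : x ∈ boxDom S) (h : hq n M q x ≠ 0) : q ∈ ctrs P := by
  rw [mem_ctrs]
  intro μ
  have hNpos : (0 : ℝ) < ((n * M : ℕ) : ℝ) := by exact_mod_cast hN
  have hb := abs_lt_of_hq_ne_zero hN h μ
  obtain ⟨h0, h1⟩ := (mem_boxDom.1 hx) μ
  rw [hS μ] at h1
  have h0' : (0 : ℝ) ≤ ((x μ : ℤ) : ℝ) := by exact_mod_cast h0
  have h1' : ((x μ : ℤ) : ℝ) + 1 ≤ ((n * M : ℕ) : ℝ) * (P μ : ℝ) := by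
    have : x μ + 1 ≤ ((n * M * P μ : ℕ) : ℤ) := by omega
    have := (Int.cast_le (R := ℝ)).2 this
    push_cast at this ⊢
    linarith
  rw [abs_lt] at hb
  simp only [pos] at hb
  obtain ⟨hb1, hb2⟩ := hb
  constructor
  · -- `q_μ > −⅝ − … ` hence `q_μ ≥ 0`
    have : (-1 : ℝ) < (q μ : ℝ) := by
      by_contra hc
      have hc' : (q μ : ℝ) ≤ -1 := le_of_not_gt hc
      have : ((n * M : ℕ) : ℝ) * (q μ : ℝ) ≤ ((n * M : ℕ) : ℝ) * (-1) := mul_le_mul_of_nonneg_left hc' hNpos.le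
      linarith
    exact_mod_cast (show (-1 : ℤ) < q μ by exact_mod_cast this)
  · have : (q μ : ℝ) < (P μ : ℝ) + 1 := by
      by_contra hc
      have hc' : (P μ : ℝ) + 1 ≤ (q μ : ℝ) := le_of_not_gt hc
      have : ((n * M : ℕ) : ℝ) * ((P μ : ℝ) + 1) ≤ ((n * M : ℕ) : ℝ) * (q μ : ℝ) :=
        mul_le_mul_of_nonneg_left hc' hNpos.le
      nlinarith
    have : q μ < (P μ : ℤ) + 1 := by exact_mod_cast this
    omega

/-- **[B6] (2.36) AT MESH `L^{−j}` WITH THE PRINTED PROFILE**: `Σ_{q ∈ Π[0,P_μ]} h_q(x)² = 1` at every fine site of the box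
`Π_μ[0, S_μ)`, `S_μ = N·P_μ` (`hasSum_hCube_sq` = (1.118) tensorised, restricted to the centres that can contribute).
[cite: Balaban1984PropagatorsII, (2.36) p.229; Balaban1984PropagatorsI, (1.118) p.36] -/
theorem sum_hq_sq {n M : ℕ} (hN : 1 ≤ n * M) {P S : Fin (d + 1) → ℕ} (hS : ∀ i, S i = n * M * P i)
    {x : Fin (d + 1) → ℤ} (hx : x ∈ boxDom S) : ∑ q ∈ ctrs P, hq n M q x ^ 2 = 1 :=
  sum_hCube_sq _ _ _ fun _ h => mem_ctrs_of_hq_ne_zero hN hS hx h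

/-! ## §3 «∂h = O(M⁻¹)»: the unit-scale Lipschitz size -/

/-- `|Π_μ f_μ − Π_μ g_μ| ≤ Σ_μ |f_μ − g_μ|` for `[0,1]`-valued factors. [folklore] -/
private theorem abs_prod_sub_prod_le {ι : Type*} (s : Finset ι) {f g : ι → ℝ} (hf : ∀ i, 0 ≤ f i ∧ f i ≤ 1)
    (hg : ∀ i, 0 ≤ g i ∧ g i ≤ 1) : |∏ i ∈ s, f i - ∏ i ∈ s, g i| ≤ ∑ i ∈ s, |f i - g i| := by
  classical
  induction s using Finset.induction_on with
  | empty => simp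
  | @insert a s ha ih =>
    rw [Finset.prod_insert ha, Finset.prod_insert ha, Finset.sum_insert ha]
    have hPf : 0 ≤ ∏ i ∈ s, f i ∧ ∏ i ∈ s, f i ≤ 1 :=
      ⟨Finset.prod_nonneg fun i _ => (hf i).1, Finset.prod_le_one (fun i _ => (hf i).1) fun i _ => (hf i).2⟩
    have e : f a * ∏ i ∈ s, f i - g a * ∏ i ∈ s, g i
        = (f a - g a) * ∏ i ∈ s, f i + g a * (∏ i ∈ s, f i - ∏ i ∈ s, g i) := by ring
    rw [e]
    calc |(f a - g a) * ∏ i ∈ s, f i + g a * (∏ i ∈ s, f i - ∏ i ∈ s, g i)|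
        ≤ |(f a - g a) * ∏ i ∈ s, f i| + |g a * (∏ i ∈ s, f i - ∏ i ∈ s, g i)| := abs_add_le _ _
      _ ≤ |f a - g a| + |∏ i ∈ s, f i - ∏ i ∈ s, g i| := by
          rw [abs_mul, abs_mul, abs_of_nonneg hPf.1, abs_of_nonneg (hg a).1]
          exact add_le_add (mul_le_of_le_one_right (abs_nonneg _) hPf.2)
            (mul_le_of_le_one_left (abs_nonneg _) (hg a).2)
      _ ≤ |f a - g a| + ∑ i ∈ s, |f i - g i| := by gcongr

/-- **«∂h = O(M^{−1})», UNIT-SCALE LIPSCHITZ SIZE OF THE PRINTED CUT-OFF**: with `κ₁ = (d+1)·sup|h′|/M`,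
`|h_q(z′) − h_q(z)| ≤ κ₁·|z′ − z|_∞/n` for all fine sites (the form consumed by `B6Ineq243TwoLevelBox.ineq244_twoLevel`).
[cite: Balaban1984PropagatorsII, (2.40)/(2.44) p.230; Balaban1983RegularityDecay, §2 p.577 («|∂^ηh_j| ≤ O(M⁻¹)»)] -/
theorem abs_hq_sub_le {n M : ℕ} (hn : 1 ≤ n) (hM : 1 ≤ M) (q z z' : Fin (d + 1) → ℤ) :
    |hq n M q z' - hq n M q z| ≤ (d + 1) * D1 hprof / M * supNorm (z' - z) / n := by
  have hn' : (0 : ℝ) < n := by exact_mod_cast hn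
  have hM' : (0 : ℝ) < M := by exact_mod_cast hM
  have hNM : ((n * M : ℕ) : ℝ) = (n : ℝ) * M := by push_cast; ring
  have hD1 := D1_nonneg contDiff_hprof hasCompactSupport_hprof
  unfold hq hCube
  calc |∏ μ, hprof (pos z' μ / ((n * M : ℕ) : ℝ) - q μ) - ∏ μ, hprof (pos z μ / ((n * M : ℕ) : ℝ) - q μ)|
      ≤ ∑ μ, |hprof (pos z' μ / ((n * M : ℕ) : ℝ) - q μ) - hprof (pos z μ / ((n * M : ℕ) : ℝ) - q μ)| :=
        abs_prod_sub_prod_le _ (fun μ => ⟨hprof_nonneg _, hprof_le_one _⟩) (fun μ => ⟨hprof_nonneg _, hprof_le_one _⟩)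
    _ ≤ ∑ _μ : Fin (d + 1), D1 hprof / M * supNorm (z' - z) / n := by
        refine Finset.sum_le_sum fun μ _ => ?_
        refine (abs_sub_le_D1 contDiff_hprof hasCompactSupport_hprof _ _).trans ?_
        rw [show pos z' μ / ((n * M : ℕ) : ℝ) - q μ - (pos z μ / ((n * M : ℕ) : ℝ) - q μ)
            = ((((z' μ : ℤ) : ℝ)) - ((z μ : ℤ) : ℝ)) / ((n : ℝ) * M) by rw [hNM]; simp only [pos]; field_simp; ring,
          abs_div, abs_of_pos (by positivity : (0 : ℝ) < n * M)]
        have h1 : |(((z' μ : ℤ) : ℝ)) - ((z μ : ℤ) : ℝ)| ≤ supNorm (z' - z) := by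
          have := abs_le_supNorm (z' - z) μ
          rw [Pi.sub_apply] at this
          push_cast at this
          exact this
        calc D1 hprof * (|(((z' μ : ℤ) : ℝ)) - ((z μ : ℤ) : ℝ)| / ((n : ℝ) * M))
            ≤ D1 hprof * (supNorm (z' - z) / ((n : ℝ) * M)) := by gcongr
          _ = D1 hprof / M * supNorm (z' - z) / n := by field_simp
    _ = (d + 1) * D1 hprof / M * supNorm (z' - z) / n := by
        rw [Finset.sum_const, Finset.card_univ, Fintype.card_fin, nsmul_eq_mul]
        push_cast
        ring

/-! ## §4 The cut cubes `□_q = Ω ∩ Π_μ[N(q_μ−1), N(q_μ+1))` as sub-boxes -/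

/-- the lower corner of the cut cube of centre `q`, in half-widths: `max(q_μ − 1, 0)`.
[cite: Balaban1983RegularityDecay, §2 p.575 («□_j = Ω ∩ {…}»)] -/
def cubeLo (q : Fin (d + 1) → ℤ) : Fin (d + 1) → ℕ := fun i => (q i).toNat - 1

/-- the width of the cut cube of centre `q`, in half-widths: `min(q_μ + 1, P_μ) − max(q_μ − 1, 0) ∈ {1, 2}`
(«a cube of the size 2M … For Mj lying on the boundary … a sum of several (≤ 2^d) large blocks»).
[cite: Balaban1983RegularityDecay, §2 p.575] -/
def cubeW (P : Fin (d + 1) → ℕ) (q : Fin (d + 1) → ℤ) : Fin (d + 1) → ℕ :=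
  fun i => min ((q i).toNat + 1) (P i) - ((q i).toNat - 1)

/-- the centre seen from the sub-box: `locLabel q = q − cubeLo q ∈ {0, 1}^{d+1}` (`0` iff the centre lies on the lower
face of `Ω` in that direction). [cite: Balaban1983RegularityDecay, §2 p.575] -/
def locLabel (q : Fin (d + 1) → ℤ) : Fin (d + 1) → ℤ := fun i => q i - (cubeLo q i : ℤ)

/-- the cut cube lies inside `Ω`: `cubeLo + cubeW ≤ P`. [cite: Balaban1983RegularityDecay, §2 p.575] -/
theorem cubeLo_add_cubeW_le {P : Fin (d + 1) → ℕ} (hP : ∀ i, 1 ≤ P i) {q : Fin (d + 1) → ℤ} (hq : q ∈ ctrs P)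
    (i : Fin (d + 1)) : cubeLo q i + cubeW P q i ≤ P i := by
  have h := (mem_ctrs.1 hq) i
  have hP' := hP i
  unfold cubeLo cubeW
  have : (q i).toNat ≤ P i := by omega
  omega

/-- the cut cube has width `1` or `2` half-widths, in particular `≥ 1`. [cite: Balaban1983RegularityDecay, §2 p.575] -/
theorem one_le_cubeW {P : Fin (d + 1) → ℕ} (hP : ∀ i, 1 ≤ P i) {q : Fin (d + 1) → ℤ} (hq : q ∈ ctrs P)
    (i : Fin (d + 1)) : 1 ≤ cubeW P q i ∧ cubeW P q i ≤ 2 := by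
  have h := (mem_ctrs.1 hq) i
  have hP' := hP i
  unfold cubeW
  have : (q i).toNat ≤ P i := by omega
  omega

/-- the local label is `0` or `1`. [cite: Balaban1983RegularityDecay, §2 p.575] -/
theorem locLabel_eq {P : Fin (d + 1) → ℕ} {q : Fin (d + 1) → ℤ} (hq : q ∈ ctrs P) (i : Fin (d + 1)) :
    locLabel q i = 0 ∨ locLabel q i = 1 := by
  have h := (mem_ctrs.1 hq) i
  unfold locLabel cubeLo
  have : ((q i).toNat : ℤ) = q i := Int.toNat_of_nonneg h.1
  omega

/-- THE CASE ANALYSIS of a cut cube in one direction: (lower face) `locLabel = 0` and the lower face is the face `q_μ = 0`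
of `Ω`, or `locLabel = 1`; (upper face) the width is `locLabel + 1` (the cube reaches `N(q_μ+1) ≤ NP_μ`), or the width is
`locLabel` and the upper face is the face `q_μ = P_μ` of `Ω`. [cite: Balaban1983RegularityDecay, §2 p.575] -/
theorem cubeW_cases {P : Fin (d + 1) → ℕ} (hP : ∀ i, 1 ≤ P i) {q : Fin (d + 1) → ℤ} (hq : q ∈ ctrs P) (i : Fin (d + 1)) :
    (locLabel q i = 0 ∨ locLabel q i = 1)
      ∧ ((cubeW P q i : ℤ) = locLabel q i + 1 ∨ ((cubeW P q i : ℤ) = locLabel q i ∧ locLabel q i = 1)) := by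
  have h := (mem_ctrs.1 hq) i
  have hP' := hP i
  refine ⟨locLabel_eq hq i, ?_⟩
  unfold locLabel cubeLo cubeW
  have e : ((q i).toNat : ℤ) = q i := Int.toNat_of_nonneg h.1
  have : (q i).toNat ≤ P i := by omega
  by_cases hlt : (q i).toNat + 1 ≤ P i
  · left
    rw [min_eq_left hlt]
    omega
  · right
    have hlt' : P i ≤ (q i).toNat + 1 := le_of_not_ge hlt
    rw [min_eq_right hlt']
    have : (q i).toNat = P i := by omega
    constructor <;> omega

/-- a translate by whole half-widths relabels the cut-off: `h_q(z + N·s) = h_{q − s}(z)`.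
[cite: Balaban1984PropagatorsI, (1.118) p.36 (translation structure of the family)] -/
theorem hq_add_mul (n M : ℕ) (hN : 1 ≤ n * M) (q s z : Fin (d + 1) → ℤ) :
    hq n M q (z + fun i => ((n * M : ℕ) : ℤ) * s i) = hq n M (q - s) z := by
  have hNpos : (0 : ℝ) < ((n * M : ℕ) : ℝ) := by exact_mod_cast hN
  unfold hq hCube
  refine Finset.prod_congr rfl fun μ _ => ?_
  congr 1
  simp only [pos, Pi.add_apply, Pi.sub_apply, Int.cast_add, Int.cast_mul, Int.cast_natCast, Int.cast_sub]
  field_simp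
  ring

/-- **THE CUT-OFF SEEN FROM THE SUB-BOX**: `h_q(z + N·cubeLo q) = h_{locLabel q}(z)`.
[cite: Balaban1983RegularityDecay, §2 p.575; Balaban1984PropagatorsI, (1.118) p.36] -/
theorem hq_shift (n M : ℕ) (hN : 1 ≤ n * M) (q z : Fin (d + 1) → ℤ) :
    hq n M q (z + fun i => ((n * M : ℕ) : ℤ) * (cubeLo q i : ℤ)) = hq n M (locLabel q) z := by
  rw [hq_add_mul n M hN]
  rfl

/-! ## §5 «Δh = O(M⁻²)» on every cut cube, faces included -/

/-- the in-box neighbour sum split by directions and signs (the Neumann box: «the summation is over the set of all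
bonds b = ⟨b₋,b₊⟩ with end-points b₋, b₊ in Ω»). [cite: Balaban1983RegularityDecay, (1.3) p.572, dictionary] -/
theorem sum_boxNbrs_eq (S : Fin (d + 1) → ℕ) (z : ↥(boxDom S)) (φ : (Fin (d + 1) → ℤ) → ℝ) :
    ∑ z' ∈ boxNbrs S z, φ z'.1
      = ∑ μ, ((if z.1 + Pi.single μ 1 ∈ boxDom S then φ (z.1 + Pi.single μ 1) else 0)
          + (if z.1 - Pi.single μ 1 ∈ boxDom S then φ (z.1 - Pi.single μ 1) else 0)) := by
  classical
  have h1 : ∑ z' ∈ boxNbrs S z, φ z'.1 = ∑ w ∈ nbrs z.1, (if w ∈ boxDom S then φ w else 0) := by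
    unfold boxNbrs
    rw [Finset.sum_filter, Finset.sum_coe_sort (boxDom S) (fun w => if w ∈ nbrs z.1 then φ w else 0),
      ← Finset.sum_filter, ← Finset.sum_filter]
    refine Finset.sum_congr ?_ fun _ _ => rfl
    ext w
    simp only [Finset.mem_filter, and_comm]
  have h2 := sum_nbrs (fun w => ((if w ∈ boxDom S then φ w else 0 : ℝ) : ℂ)) z.1
  rw [h1, Finset.sum_add_distrib]
  exact_mod_cast h2

/-- the forward bond `⟨z, z + e_μ⟩` lies in the box iff `z_μ + 1 < S_μ`. [cite: Balaban1983RegularityDecay, (1.3) p.572, dictionary] -/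
theorem add_single_mem_boxDom_iff {S : Fin (d + 1) → ℕ} (z : ↥(boxDom S)) (μ : Fin (d + 1)) :
    z.1 + Pi.single μ 1 ∈ boxDom S ↔ z.1 μ + 1 < S μ := by
  have hz := mem_boxDom.1 z.2
  rw [mem_boxDom]
  constructor
  · intro h; have := (h μ).2; simpa using this
  · intro h i
    by_cases hi : i = μ
    · subst hi; simp; constructor <;> linarith [(hz i).1]
    · simp [hi]; exact hz i

/-- the backward bond `⟨z − e_μ, z⟩` lies in the box iff `1 ≤ z_μ`. [cite: Balaban1983RegularityDecay, (1.3) p.572, dictionary] -/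
theorem sub_single_mem_boxDom_iff {S : Fin (d + 1) → ℕ} (z : ↥(boxDom S)) (μ : Fin (d + 1)) :
    z.1 - Pi.single μ 1 ∈ boxDom S ↔ 1 ≤ z.1 μ := by
  have hz := mem_boxDom.1 z.2
  rw [mem_boxDom]
  constructor
  · intro h; have := (h μ).1; simp at this; omega
  · intro h i
    by_cases hi : i = μ
    · subst hi; simp; constructor <;> linarith [(hz i).2]
    · simp [hi]; exact hz i

/-- moving a fine site along `μ` moves its position along `μ`. [folklore] -/
private theorem pos_add_single (z : Fin (d + 1) → ℤ) (μ : Fin (d + 1)) (s : ℤ) :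
    pos (z + Pi.single μ s) = Function.update (pos z) μ (pos z μ + s) := by
  funext ν
  by_cases h : ν = μ
  · subst h; simp [pos]; ring
  · simp [pos, h]

/-- the value of `h_q` at a site moved along `μ`, the `μ`-factor split off. [cite: Balaban1984PropagatorsI, (1.118) p.36] -/
theorem hq_add_single (n M : ℕ) (q z : Fin (d + 1) → ℤ) (μ : Fin (d + 1)) (s : ℤ) :
    hq n M q (z + Pi.single μ s) = hprof ((pos z μ + s) / ((n * M : ℕ) : ℝ) - q μ)
      * ∏ ν ∈ Finset.univ.erase μ, hprof (pos z ν / ((n * M : ℕ) : ℝ) - q ν) := by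
  rw [hq_eq_mul_prod n M q _ μ, pos_add_single]
  congr 1
  · rw [Function.update_self]
  · refine Finset.prod_congr rfl fun ν hν => ?_
    rw [Function.update_of_ne (Finset.ne_of_mem_erase hν)]

/-- ONE DIRECTION OF A CUT CUBE, the four face situations: for `N ≥ 4`, label `c ∈ {0,1}` and width `w` with
`w = c + 1 ∨ (w = c ∧ c = 1)`, the profile `f(t) = h((t + ½)/N − c)` on the integer range `[0, Nw)` has VANISHING
ONE-SIDED DIFFERENCES at both ends: `f(1) = f(0)` and `f(Nw − 2) = f(Nw − 1)` (plateau `h = 1` at a face of `Ω` through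
the centre, `h = 0` at an internal face). [cite: Balaban1984PropagatorsI, (1.118) p.36 («h(t) = 1 for t ∈ [−⅓,⅓]», «C₀^∞(]−⅔,⅔[)»)] -/
theorem face_diff_eq_zero {N : ℕ} (hN : 4 ≤ N) {c : ℤ} {w : ℕ} (hc : c = 0 ∨ c = 1)
    (hw : (w : ℤ) = c + 1 ∨ ((w : ℤ) = c ∧ c = 1)) :
    hprof (((0 : ℝ) + 1 / 2 + 1) / N - c) = hprof (((0 : ℝ) + 1 / 2) / N - c)
      ∧ hprof ((((N * w : ℕ) : ℝ) - 2 + 1 / 2) / N - c) = hprof ((((N * w : ℕ) : ℝ) - 1 + 1 / 2) / N - c) := by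
  have hN' : (4 : ℝ) ≤ N := by exact_mod_cast hN
  have hNpos : (0 : ℝ) < N := by linarith
  have hs3 : ((0 : ℝ) + 1 / 2 + 1) / N ≤ 3 / 8 := by rw [div_le_iff₀ hNpos]; linarith
  have hs1 : ((0 : ℝ) + 1 / 2) / N ≤ 3 / 8 := by rw [div_le_iff₀ hNpos]; linarith
  have hp3 : 0 ≤ ((0 : ℝ) + 1 / 2 + 1) / N := by positivity
  have hp1 : 0 ≤ ((0 : ℝ) + 1 / 2) / N := by positivity
  have hw' : ((w : ℕ) : ℝ) = ((w : ℤ) : ℝ) := rfl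
  constructor
  · rcases hc with rfl | rfl
    · -- plateau at the lower face of Ω: both values are 1
      rw [hprof_eq_one, hprof_eq_one]
      · rw [Int.cast_zero, sub_zero, abs_of_nonneg hp1]; exact hs1
      · rw [Int.cast_zero, sub_zero, abs_of_nonneg hp3]; exact hs3
    · -- internal (or far) lower face: both values are 0
      rw [hprof_eq_zero, hprof_eq_zero]
      · rw [Int.cast_one, abs_of_nonpos (by linarith), neg_sub]; linarith
      · rw [Int.cast_one, abs_of_nonpos (by linarith), neg_sub]; linarith
  · rcases hw with hw | ⟨hw, rfl⟩
    · -- the cube reaches N(c+1): both values are 0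
      have ew : ((N * w : ℕ) : ℝ) = (N : ℝ) * (c + 1) := by
        push_cast; rw [hw', hw]; push_cast; ring
      have e2 : ((N : ℝ) * (c + 1) - 2 + 1 / 2) / N - c = 1 - (3 / 2) / N := by field_simp; ring
      have e1 : ((N : ℝ) * (c + 1) - 1 + 1 / 2) / N - c = 1 - (1 / 2) / N := by field_simp; ring
      have hb2 : (3 / 2 : ℝ) / N ≤ 3 / 8 := by rw [div_le_iff₀ hNpos]; linarith
      have hb1 : (1 / 2 : ℝ) / N ≤ 3 / 8 := by rw [div_le_iff₀ hNpos]; linarith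
      rw [ew, e2, e1, hprof_eq_zero, hprof_eq_zero]
      · rw [abs_of_nonneg (by linarith)]; linarith
      · rw [abs_of_nonneg (by linarith)]; linarith
    · -- plateau at the upper face of Ω (width = label = 1): both values are 1
      have ew : ((N * w : ℕ) : ℝ) = (N : ℝ) := by
        push_cast; rw [hw', hw]; simp
      have e2 : ((N : ℝ) - 2 + 1 / 2) / N - (1 : ℤ) = -((3 / 2) / N) := by push_cast; field_simp; ring
      have e1 : ((N : ℝ) - 1 + 1 / 2) / N - (1 : ℤ) = -((1 / 2) / N) := by push_cast; field_simp; ring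
      have hb2 : (3 / 2 : ℝ) / N ≤ 3 / 8 := by rw [div_le_iff₀ hNpos]; linarith
      have hb1 : (1 / 2 : ℝ) / N ≤ 3 / 8 := by rw [div_le_iff₀ hNpos]; linarith
      rw [ew, e2, e1, hprof_eq_one, hprof_eq_one]
      · rw [abs_neg, abs_of_nonneg (by positivity)]; exact hb1
      · rw [abs_neg, abs_of_nonneg (by positivity)]; exact hb2

/-- **«Δh = O(M^{−2})» ON EVERY CUT CUBE, FACES INCLUDED**: on the sub-box `Π_μ[0, N·w_μ)` carrying the cut-off
`h_c` (fine sides `S_μ = N·w_μ`), `c ∈ {0,1}^{d+1}`, `w_μ = c_μ + 1 ∨ (w_μ = c_μ = 1)` (the four face situations of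
[3] p. 575), for `N ≥ 4`:
`|Σ_{z′ ∼ z, z′ ∈ □}(h_c(z′) − h_c(z))| ≤ (d+1)·sup|h″|/N²` at EVERY site (times `n²`: the unit-scale Laplacian bound
`κ₂ = (d+1)·sup|h″|/M²` of `B6Ineq243TwoLevelBox.ineq244_twoLevel`).
[cite: Balaban1984PropagatorsII, (2.40)/(2.44) p.230; Balaban1983RegularityDecay, §2 p.577 («|Δ^ηh_j| ≤ O(M⁻²)»)] -/
theorem hloc_laplacian {n M : ℕ} (hN : 4 ≤ n * M) {c : Fin (d + 1) → ℤ} {w S : Fin (d + 1) → ℕ}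
    (hS : ∀ i, S i = n * M * w i)
    (hc : ∀ i, c i = 0 ∨ c i = 1) (hw : ∀ i, (w i : ℤ) = c i + 1 ∨ ((w i : ℤ) = c i ∧ c i = 1))
    (z : ↥(boxDom S)) :
    |∑ z' ∈ boxNbrs S z, (hq n M c z'.1 - hq n M c z.1)| ≤ (d + 1) * (D2 hprof / ((n * M : ℕ) : ℝ) ^ 2) := by
  have hN1 : 1 ≤ n * M := le_trans (by norm_num) hN
  have hNpos : (0 : ℝ) < ((n * M : ℕ) : ℝ) := by exact_mod_cast hN1
  have hz := mem_boxDom.1 z.2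
  have hD2 := D2_nonneg contDiff_hprof hasCompactSupport_hprof
  rw [sum_boxNbrs_eq S z (fun v => hq n M c v - hq n M c z.1)]
  refine (Finset.abs_sum_le_sum_abs _ _).trans ?_
  have hbound : ∀ μ : Fin (d + 1),
      |(if z.1 + Pi.single μ 1 ∈ boxDom S then hq n M c (z.1 + Pi.single μ 1) - hq n M c z.1 else 0)
        + (if z.1 - Pi.single μ 1 ∈ boxDom S then hq n M c (z.1 - Pi.single μ 1) - hq n M c z.1 else 0)|
        ≤ D2 hprof / ((n * M : ℕ) : ℝ) ^ 2 := by
    intro μ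
    set R := ∏ ν ∈ Finset.univ.erase μ, hprof (pos z.1 ν / ((n * M : ℕ) : ℝ) - c ν) with hR
    have hRm := prod_erase_mem n M c z.1 μ
    rw [← hR] at hRm
    set t : ℝ := pos z.1 μ / ((n * M : ℕ) : ℝ) - c μ with ht
    have e0 : hq n M c z.1 = hprof t * R := by rw [hq_eq_mul_prod n M c z.1 μ]
    have eplus : hq n M c (z.1 + Pi.single μ 1) = hprof (t + 1 / ((n * M : ℕ) : ℝ)) * R := by
      rw [hq_add_single, ht]; congr 2; push_cast; ring
    have eminus : hq n M c (z.1 - Pi.single μ 1) = hprof (t - 1 / ((n * M : ℕ) : ℝ)) * R := by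
      rw [show z.1 - Pi.single μ (1 : ℤ) = z.1 + Pi.single μ (-1) by rw [Pi.single_neg, sub_eq_add_neg],
        hq_add_single, ht]
      congr 2; push_cast; ring
    obtain ⟨h0, h1⟩ := hz μ
    rw [hS μ] at h1
    by_cases hup : z.1 + Pi.single μ 1 ∈ boxDom S <;> by_cases hdn : z.1 - Pi.single μ 1 ∈ boxDom S
    · -- interior: a second difference
      rw [if_pos hup, if_pos hdn, eplus, eminus, e0,
        show hprof (t + 1 / ((n * M : ℕ) : ℝ)) * R - hprof t * R + (hprof (t - 1 / ((n * M : ℕ) : ℝ)) * R - hprof t * R)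
          = (hprof (t + 1 / ((n * M : ℕ) : ℝ)) - 2 * hprof t + hprof (t - 1 / ((n * M : ℕ) : ℝ))) * R by ring,
        abs_mul, abs_of_nonneg hRm.1]
      calc |hprof (t + 1 / ((n * M : ℕ) : ℝ)) - 2 * hprof t + hprof (t - 1 / ((n * M : ℕ) : ℝ))| * R
          ≤ D2 hprof * (1 / ((n * M : ℕ) : ℝ)) ^ 2 * 1 :=
            mul_le_mul (abs_second_diff_le_D2 contDiff_hprof hasCompactSupport_hprof _ _) hRm.2 hRm.1 (by positivity)
        _ = D2 hprof / ((n * M : ℕ) : ℝ) ^ 2 := by field_simp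
    · -- lower face `z_μ = 0`: the one-sided difference vanishes
      have hdn' : ¬ 1 ≤ z.1 μ := fun h => hdn ((sub_single_mem_boxDom_iff z μ).2 h)
      have hz0 : z.1 μ = 0 := by omega
      rw [if_pos hup, if_neg hdn, add_zero, eplus, e0, ← sub_mul, abs_mul, abs_of_nonneg hRm.1]
      have key := (face_diff_eq_zero hN (hc μ) (hw μ)).1
      have et : t = ((0 : ℝ) + 1 / 2) / ((n * M : ℕ) : ℝ) - c μ := by
        rw [ht]; simp only [pos, hz0, Int.cast_zero]
      have et' : t + 1 / ((n * M : ℕ) : ℝ) = ((0 : ℝ) + 1 / 2 + 1) / ((n * M : ℕ) : ℝ) - c μ := by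
        rw [et]; field_simp; ring
      rw [et', et, key, sub_self, abs_zero, zero_mul]
      positivity
    · -- upper face `z_μ = Nw − 1`
      have hup' : ¬ z.1 μ + 1 < ((n * M * w μ : ℕ) : ℤ) := fun h =>
        hup ((add_single_mem_boxDom_iff z μ).2 (by rw [hS μ]; exact h))
      have hzt : z.1 μ = ((n * M * w μ : ℕ) : ℤ) - 1 := by
        have e1 := Int.lt_iff_add_one_le.mp h1
        have e2 := not_lt.mp hup'
        linarith
      rw [if_neg hup, if_pos hdn, zero_add, eminus, e0, ← sub_mul, abs_mul, abs_of_nonneg hRm.1]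
      have key := (face_diff_eq_zero hN (hc μ) (hw μ)).2
      have et : t = ((((n * M) * w μ : ℕ) : ℝ) - 1 + 1 / 2) / ((n * M : ℕ) : ℝ) - c μ := by
        rw [ht]; simp only [pos, hzt]; push_cast; ring
      have et' : t - 1 / ((n * M : ℕ) : ℝ) = ((((n * M) * w μ : ℕ) : ℝ) - 2 + 1 / 2) / ((n * M : ℕ) : ℝ) - c μ := by
        rw [et]; field_simp; ring
      rw [et', et, key, sub_self, abs_zero, zero_mul]
      positivity
    · -- a one-site direction (`Nw = 1`): impossible for `N ≥ 4`, and anyway both terms vanish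
      rw [if_neg hup, if_neg hdn, add_zero, abs_zero]
      positivity
  calc ∑ μ, |(if z.1 + Pi.single μ 1 ∈ boxDom S then hq n M c (z.1 + Pi.single μ 1) - hq n M c z.1
          else 0) + (if z.1 - Pi.single μ 1 ∈ boxDom S then hq n M c (z.1 - Pi.single μ 1)
          - hq n M c z.1 else 0)|
      ≤ ∑ _μ : Fin (d + 1), D2 hprof / ((n * M : ℕ) : ℝ) ^ 2 := Finset.sum_le_sum fun μ _ => hbound μ
    _ = (d + 1) * (D2 hprof / ((n * M : ℕ) : ℝ) ^ 2) := by
        rw [Finset.sum_const, Finset.card_univ, Fintype.card_fin, nsmul_eq_mul]; push_cast; ring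

/-! ## §6 The cut-off vanishes along the internal faces of its cut cube -/

/-- **LOWER INTERNAL FACE**: if the local label of direction `μ` is `1`, then `h_c` vanishes at the two site layers
`z_μ ∈ {0, 1}` of the sub-box (`N ≥ 4`). [cite: Balaban1984PropagatorsI, (1.118) p.36 («h ∈ C₀^∞(]−⅔,⅔[)»); Balaban1983RegularityDecay, §2 p.575] -/
theorem hloc_eq_zero_low {n M : ℕ} (hN : 4 ≤ n * M) {c : Fin (d + 1) → ℤ} {μ : Fin (d + 1)} (hc : c μ = 1)
    {z : Fin (d + 1) → ℤ} (hz0 : 0 ≤ z μ) (hz : z μ ≤ 1) : hq n M c z = 0 := by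
  have hN1 : 1 ≤ n * M := le_trans (by norm_num) hN
  have hN' : (4 : ℝ) ≤ ((n * M : ℕ) : ℝ) := by exact_mod_cast hN
  apply hq_eq_zero_of_le hN1 (μ := μ)
  have hz' : ((z μ : ℤ) : ℝ) ≤ 1 := by exact_mod_cast hz
  have hz0' : (0 : ℝ) ≤ ((z μ : ℤ) : ℝ) := by exact_mod_cast hz0
  simp only [pos, hc, Int.cast_one, mul_one]
  rw [abs_of_nonpos (by linarith)]
  linarith

/-- **UPPER INTERNAL FACE**: if the width of direction `μ` is `c_μ + 1` (the cube reaches `N(q_μ + 1)`), then `h_c`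
vanishes at the two site layers `z_μ ∈ {Nw_μ − 2, Nw_μ − 1}`. [cite: Balaban1984PropagatorsI, (1.118) p.36; Balaban1983RegularityDecay, §2 p.575] -/
theorem hloc_eq_zero_high {n M : ℕ} (hN : 4 ≤ n * M) {c : Fin (d + 1) → ℤ} {w : Fin (d + 1) → ℕ} {μ : Fin (d + 1)}
    (hw : (w μ : ℤ) = c μ + 1) {z : Fin (d + 1) → ℤ} (hz : ((n * M * w μ : ℕ) : ℤ) - 2 ≤ z μ) :
    hq n M c z = 0 := by
  have hN1 : 1 ≤ n * M := le_trans (by norm_num) hN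
  have hN' : (4 : ℝ) ≤ ((n * M : ℕ) : ℝ) := by exact_mod_cast hN
  apply hq_eq_zero_of_le hN1 (μ := μ)
  have ew : (((n * M * w μ : ℕ) : ℤ) : ℝ) = ((n * M : ℕ) : ℝ) * ((c μ : ℝ) + 1) := by
    have : ((w μ : ℕ) : ℝ) = ((w μ : ℤ) : ℝ) := rfl
    push_cast; rw [this, hw]; push_cast; ring
  have hz' : ((n * M : ℕ) : ℝ) * ((c μ : ℝ) + 1) - 2 ≤ ((z μ : ℤ) : ℝ) := by
    rw [← ew]; exact_mod_cast hz
  simp only [pos]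
  rw [le_abs]; left
  nlinarith

end

end Literature.MathematicalPhysics.QuantumFieldTheory.Balaban1983to89.B6Partition236TwoLevelBox
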